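import Literature.Computability.MetaComplexity.BoundedArithS2SuccIND
import HarnessLib

/-!
# `S₂ʲ⁺¹ ⊆ T₂ʲ⁺¹`: `Σᵇⱼ₊₁`-polynomial induction in models of `BASIC + Σᵇⱼ₊₁-IND`

Topic `Literature/Computability/MetaComplexity` (companion of `BoundedArithTheories.lean`,
`BoundedArithAlgebra.lean`, `BoundedArithPow2.lean`, `BoundedArithS2SuccIND.lean`).  We
discharge the named facts `S2_succ_extends_T2_succ` and `S2_extends_T2` of
`BoundedArithTheories.lean` — "`T₂ⁱ` proves every axiom of `S₂ⁱ`" for `i ≥ 1`, i.e. the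
`Σᵇᵢ-IND` axioms imply the `Σᵇᵢ-PIND` axioms over `BASIC` (Buss 1986, Thm. 2.6 and its
corollary `S₂ⁱ ⊆ T₂ⁱ`; Krajíček 1995, Lemma 5.2.8 (p. 68), "`S₂ⁱ ⊆ T₂ⁱ` is easier", via
Lemma 5.2.5 (p. 67): `S₂ⁱ = Σᵇᵢ-LIND`) — semantically (provability is Mathlib's `⊨ᵇ`): in a
structure `M ⊨ BASIC + Σᵇⱼ₊₁-IND`, polynomial induction holds for every predicate
`Σᵇⱼ₊₁`-definable with parameters (`BASICModel.pind_of_ind_succ`); hence a model of `T₂ʲ⁺¹` is a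
model of `S₂ʲ⁺¹` (`model_S2_of_model_T2_succ`), `S2_succ_extends_T2_succ_holds` and
`S2_extends_T2_holds`.

## The argument

Krajíček's proof of Lemma 5.2.5/5.2.8 (Krajíček 1995, pp. 67–68).  Work in `M ⊨ BASIC + Σᵇⱼ₊₁-IND`;
by cumulativity `M ⊨ Σᵇ₁-IND`, so the bootstrapping of `T₂¹` of `BoundedArithAlgebra.lean` and
`BoundedArithPow2.lean` is available: truncated subtraction `∸`, the powers of two
`pow2B a k = 2^{min(k,|a|)}` and Euclidean division, all `Σᵇ₁`-definable.  Suppose `A` is `Σᵇⱼ₊₁`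
(with parameters), `A(0)` and `∀x (A(⌊x/2⌋) → A(x))`, and let `a ∈ M`.  Put

  `ψ(x) :≡ A(aₓ)`,  `aₓ := ⌊a / 2^{|a| ∸ x}⌋` ("the number consisting of the first `x` bits of `a`").

`ψ` is again `Σᵇⱼ₊₁` (substitution of a `Σᵇ₁`-definable function, Buss 1986, Thm. 2.2), `ψ(0)`
holds as `a₀ = ⌊a/2^{|a|}⌋ = 0`, and `ψ(x) → ψ(x+1)`: for `x < |a|`, `2^{|a| ∸ x} = 2·2^{|a| ∸ (x+1)}`
so `aₓ = ⌊aₓ₊₁/2⌋` and the `PIND` step applies; for `x ≥ |a|`, `aₓ₊₁ = aₓ`.  By `Σᵇⱼ₊₁-IND`,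
`ψ(|a|)`, i.e. `A(⌊a/2⁰⌋) = A(a)`.  (Krajíček concludes with `Σᵇᵢ-LIND`, which `T₂ⁱ` trivially
proves; running the ordinary induction up to `|a|` is the same thing.)

## Main statements

* `BASICModel.pind_of_ind_succ`: **`Σᵇⱼ₊₁-PIND` in models of `BASIC + Σᵇⱼ₊₁-IND`**;
* `pind_of_model_T2_succ`, `model_S2_of_model_T2_succ`: a model of `T₂ʲ⁺¹` satisfies
  `Σᵇⱼ₊₁-PIND`, hence is a model of `S₂ʲ⁺¹`;
* `S2_succ_extends_T2_succ_holds`: discharge of `S2_succ_extends_T2_succ`;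
* `S2_extends_T2_holds`: discharge of `S2_extends_T2` (the form with hypothesis `1 ≤ i`).

## References

* S. R. Buss, *Bounded Arithmetic*, Bibliopolis 1986, Ch. 2: Thm. 2.6 and its corollary
  `S₂ⁱ ⊆ T₂ⁱ` (`i ≥ 1`); Thm. 2.2 (substitution of `Σᵇ₁`-defined functions).
* J. Krajíček, *Bounded Arithmetic, Propositional Logic and Complexity Theory*, CUP 1995,
  Lemma 5.2.5 (p. 67: `S₂ⁱ = Σᵇᵢ-LIND`, proof via `ψ(x) := φ(aₓ)`), Lemma 5.2.8 (p. 68: for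
  `i ≥ 1`, `S₂ⁱ ⊆ T₂ⁱ ⊆ S₂ⁱ⁺¹`).

## Design choices

* Everything is proved in an arbitrary structure `M ⊨ BASIC` carrying the scheme `Σᵇⱼ₊₁-IND`
  (instance argument `[M ⊨ BASIC]`, hypothesis `M ⊨ INDScheme (sigmabFormulas (j+1))`), in the
  algebraic notation of `BoundedArithAlgebra.lean` (namespace `BASICModel`), and then specialised
  to models of `T₂ʲ⁺¹ = BASIC + Σᵇⱼ₊₁-IND`.
* The level is written `j + 1`: the case `i = 0` (`T₂⁰ ⊢ Σᵇ₀-PIND`?) is not a theorem of the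
  cited sources and is not claimed (cf. the docstring of `S2_extends_T2`); the bootstrapping used
  here genuinely needs `Σᵇ₁-IND`.
-/

namespace Literature.Computability.MetaComplexity

open FirstOrder FirstOrder.Language

namespace BASICModel

variable {M : Type} [Language.boundedArith.Structure M] [hB : M ⊨ BASIC]

/-! ## `Σᵇⱼ₊₁`-polynomial induction from `Σᵇⱼ₊₁`-induction -/

section PIND

/-- The induction predicate of Krajíček's argument is `Σᵇⱼ₊₁`: for `A ∈ Σᵇⱼ₊₁` (with
parameters) and a parameter `a`, `ψ(x) :≡ A(⌊a / 2^{|a| ∸ x}⌋)` is `Σᵇⱼ₊₁`-definable with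
parameters, in a model of `BASIC + Σᵇ₁-IND` — substitution of the `Σᵇ₁`-definable functions
`∸` and `(x, k) ↦ ⌊x/2ᵏ⌋` into a `Σᵇⱼ₊₁` formula (Buss 1986, Thm. 2.2; Krajíček 1995, proof of
Lemma 5.2.5, p. 67: "`ψ(x)` is `Σᵇᵢ` as `aₓ = y` is `Σᵇ₁`-definable"). [cite: Krajicek1995, Lemma 5.2.5 (p. 67)] -/
theorem isSigmabDef_prefix [M ⊨ INDScheme (sigmabFormulas 1)] {j : ℕ} {A : M → Prop}
    (hA : IsSigmabDef (j + 1) fun v : Fin 1 → M => A (v 0)) (a : M) :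
    IsSigmabDef (j + 1) fun v : Fin 1 → M => A (a / pow2B a (mLen a - v 0)) := by
  -- `d ↦ A (⌊a / 2ᵈ⌋)` is `Σᵇⱼ₊₁`
  have h1 : IsSigmabDef (j + 1) fun v : Fin 1 → M => A (a / pow2B a (v 0)) :=
    hA.comp₁Fn ((isSigmabFn_div_pow2B.mono (Nat.le_add_left 1 j)).comp₃
      (f := fun S x k => x / pow2B S k) (IsTermFn.const a) (IsTermFn.const a) (IsTermFn.proj 0))
  -- substitute `d := |a| ∸ x`
  exact h1.comp₁Fn (P := fun d => A (a / pow2B a d))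
    (isSigmabFn_sub (isTermFn_mLen (IsTermFn.const a)) (IsTermFn.proj 0) (j + 1))

/-- **`Σᵇⱼ₊₁-PIND` in models of `BASIC + Σᵇⱼ₊₁-IND`** (`S₂ⁱ ⊆ T₂ⁱ` for `i ≥ 1`: Buss 1986,
Thm. 2.6 and its corollary; Krajíček 1995, Lemma 5.2.8 with Lemma 5.2.5, pp. 67–68): if `A ⊆ M`
is `Σᵇⱼ₊₁`-definable with parameters, `A(0)` and `∀x (A(⌊x/2⌋) → A(x))`, then `A = M`.  Proof:
`Σᵇⱼ₊₁-IND` on `x` for `ψ(x) :≡ A(⌊a / 2^{|a| ∸ x}⌋)` ("`A` holds of the first `x` bits of `a`"),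
from `ψ(0) ≡ A(0)` up to `ψ(|a|) ≡ A(a)`; the induction step is the `PIND` hypothesis since
`⌊a/2^{|a| ∸ x}⌋ = ⌊⌊a/2^{|a| ∸ (x+1)}⌋ / 2⌋` for `x < |a|`. [cite: Krajicek1995, Lemma 5.2.8 (p. 68)] -/
theorem pind_of_ind_succ {j : ℕ} (hI : M ⊨ INDScheme (sigmabFormulas (j + 1))) {A : M → Prop}
    (hA : IsSigmabDef (j + 1) fun v : Fin 1 → M => A (v 0)) (h0 : A 0)
    (hs : ∀ x, A (mHalf x) → A x) (a : M) : A a := by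
  haveI : M ⊨ INDScheme (sigmabFormulas 1) := model_INDScheme_one_of_level hI
  have key : ∀ x : M, A (a / pow2B a (mLen a - x)) := by
    intro x
    refine ind_level hI (P := fun x => A (a / pow2B a (mLen a - x))) (isSigmabDef_prefix hA a)
      ?_ ?_ x
    · -- `x = 0`: `⌊a / 2^{|a|}⌋ = 0`
      rw [tsub_zero, (div_pow2B_eq_zero_iff le_rfl a).2 le_rfl]
      exact h0
    · intro x hx
      rcases lt_or_ge x (mLen a) with hlt | hle
      · -- `x < |a|`: one more bit, `a_x = ⌊a_{x+1} / 2⌋`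
        have hd : mLen a - x = mLen a - (x + 1) + 1 := by
          refine (eq_tsub_of_add_eq ?_).symm
          rw [add_assoc, add_comm 1 x, tsub_add_cancel_of_le ((add_one_le_iff' x _).2 hlt)]
        have hd' : mLen a - (x + 1) < mLen a := by
          rw [← add_one_le_iff', ← hd]
          exact tsub_le_self
        apply hs
        rwa [← div_two_eq_mHalf, ← div_pow2B_add_one hd', ← hd]
      · -- `x ≥ |a|`: nothing changes
        rwa [tsub_eq_zero_of_le (hle.trans (le_add_right'' x 1)), ← tsub_eq_zero_of_le hle]
  simpa using key (mLen a)

end PIND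

end BASICModel

/-! ## Models of `T₂ʲ⁺¹` are models of `S₂ʲ⁺¹` -/

section Models

open BASICModel

variable {M : Type} [Language.boundedArith.Structure M] {j : ℕ}

/-- **`Σᵇⱼ₊₁-PIND` in models of `T₂ʲ⁺¹`**: in a model of `T₂ʲ⁺¹`, polynomial induction holds for
every predicate `Σᵇⱼ₊₁`-definable with parameters (Buss 1986, Thm. 2.6; Krajíček 1995,
Lemma 5.2.8, p. 68). [cite: Krajicek1995, Lemma 5.2.8 (p. 68)] -/
theorem pind_of_model_T2_succ (hM : M ⊨ T2 (j + 1)) {A : M → Prop}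
    (hA : IsSigmabDef (j + 1) fun v : Fin 1 → M => A (v 0)) (h0 : A (mZero M))
    (hs : ∀ x, A (mHalf x) → A x) (a : M) : A a := by
  haveI : M ⊨ BASIC := model_BASIC_of_model_T2 hM
  exact pind_of_ind_succ (hM.mono Set.subset_union_right) hA h0 hs a

/-- **A model of `T₂ʲ⁺¹` is a model of `S₂ʲ⁺¹`** (`S₂ⁱ ⊆ T₂ⁱ` for `i ≥ 1`; Buss 1986, Thm. 2.6
and its corollary; Krajíček 1995, Lemma 5.2.8, p. 68): it satisfies `BASIC` and, by
`pind_of_model_T2_succ`, every `Σᵇⱼ₊₁-PIND` axiom. [cite: Krajicek1995, Lemma 5.2.8 (p. 68)] -/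
theorem model_S2_of_model_T2_succ (hM : M ⊨ T2 (j + 1)) : M ⊨ S2 (j + 1) := by
  refine ⟨fun φ hφ => ?_⟩
  rcases hφ with hφ | hφ
  · exact hM.realize_of_mem φ (BASIC_subset_T2 _ hφ)
  · simp only [PINDScheme, Set.mem_iUnion, Set.mem_image] at hφ
    obtain ⟨k, ψ, hψ, rfl⟩ := hφ
    rw [realize_pindAxiom_iff]
    intro p h0 hs a
    exact pind_of_model_T2_succ hM (A := fun x => ψ.Realize (Fin.snoc p x))
      (hψ.isSigmabDef_realize_snoc p) h0 hs a

end Models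

/-- **Discharge of `S2_succ_extends_T2_succ`**: for every `j`, `T₂ʲ⁺¹` extends `S₂ʲ⁺¹` — every
axiom of `S₂ʲ⁺¹` (the axioms of `BASIC` and the `Σᵇⱼ₊₁-PIND` axioms) is a consequence (`⊨ᵇ`) of
`T₂ʲ⁺¹` (Buss 1986, Thm. 2.6 and its corollary `S₂ⁱ ⊆ T₂ⁱ`; Krajíček 1995, Lemma 5.2.8, p. 68).
[cite: Buss1986, Thm. 2.6] [cite: Krajicek1995, Lemma 5.2.8 (p. 68)] -/
theorem S2_succ_extends_T2_succ_holds : S2_succ_extends_T2_succ := by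
  intro j φ hφ
  rw [Theory.models_sentence_iff]
  intro N
  haveI : (N : Type) ⊨ S2 (j + 1) := model_S2_of_model_T2_succ N.is_model
  exact Theory.realize_sentence_of_mem (S2 (j + 1)) hφ

/-- **Discharge of `S2_extends_T2`**: for `i ≥ 1`, `T₂ⁱ` extends `S₂ⁱ` (Buss 1986, Thm. 2.6 and
its corollary `S₂ⁱ ⊆ T₂ⁱ`; Krajíček 1995, Lemma 5.2.8, p. 68); from the successor form
`S2_succ_extends_T2_succ_holds` at `i = j + 1`. [cite: Buss1986, Thm. 2.6] [cite: Krajicek1995, Lemma 5.2.8 (p. 68)] -/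
theorem S2_extends_T2_holds : S2_extends_T2 := by
  intro i hi
  obtain ⟨j, rfl⟩ := Nat.exists_eq_add_of_le' hi
  exact S2_succ_extends_T2_succ_holds j

end Literature.Computability.MetaComplexity
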